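import Summits.Ventures.PercRepro.S2DichotomyTools
import Summits.Ventures.PercRepro.S2TailCell
import Summits.Ventures.PercRepro.S2SpanningCount
import Summits.Ventures.PercRepro.S2FlatCountTwo
import Summits.Ventures.PercRepro.S2PhiFourteenFive
import Summits.Ventures.PercRepro.S2CapFree
import Summits.Ventures.PercRepro.TriangleCapEightI
import Summits.Ventures.PercRepro.S1CoreCapSevenFinal
import Summits.Ventures.PercRepro.S1FiveCircuitBase
import Summits.Ventures.PercRepro.S2TopGraded
import Summits.Ventures.PercRepro.S2TopGradedTwo
import Summits.Ventures.PercRepro.S2TailFlats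
import Summits.Ventures.PercRepro.S2CountsCell
import Summits.Ventures.PercRepro.S2MaxExtension
import Summits.Ventures.PercRepro.S2FlatCountTwoSharp

/-!
# PercRepro — S2: THE CELL `(14, 8)`, COLOOP-FREE, BY THE SHARPENED FLAT COUNT AND THE GRADED PARTITION COUNT ON TWO LEVELS (p7, gen 13; sub-claim S2; the `p = 14` row)

The nested dichotomy on «a set `W` of nullity `k` on `≤ 5 + k` points», `k = 7, …, 4`, with the concentrated tail: `ν = 7` size by size, `ν = 6` by the
flat count sharpened at `m = 5` (`topCount_le_flat_count_two_sharp`), `ν = 5` by THE GRADED PARTITION COUNT under the sub-dichotomy on a rank-`4` flat `G`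
of `9` points — with one, `G` is unique (`eq_of_rank_four_flats_of_big`) and the maximal-closure count runs on two levels (`E = 13` for `G`, `e = 8` for every
other rank-`4` flat; `topCount_le_payment_graded_two`), `W := G`; without, every rank-`4` flat has `≤ 8` points, `e = 8`, and the rank part of the tail runs at
`f = 10`, `f′ = 8` (`ncard_eRk_le_five_le_flats`, the three-count cell theorem) — `ν = 4` by the graded count; spread with the kit's tail (`gencellg.py`;
every numeral exact; the exact `Φ(14, 5) = 380/9 ≤ 2^19/12417`; coloop-free caps `13 / 78 / 518`).
**`ThmN.c025_fourteen_eight_cfg (M) [M.Finite] (hR : ρ(E) = 14) (hn : |E| = 22) (hfree) (hK : no coloop) : RLS M 14 5`**. Axioms: standard.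
-/

open scoped Matroid

namespace PercRepro

namespace ThmN

open Set

variable {α : Type}

/-- The coloop-free caps at `(14, 8)`: `s₃ ≤ 13`, `s₄ ≤ 78` (`⌊22·64/18⌋`, the series-class averaging on `avgBoundSeven 0`), `s₅ ≤ 518` (`⌊22·401/17⌋`) on every `e`-free core of nullity `8` on `22` points without coloops. -/
theorem caps_fourteen_eight_cfg (M : Matroid α) [M.Finite]
    (hd : M.E.encard = M.eRank + ((8 : ℕ) : ℕ∞)) (hn : M.E.ncard = 14 + 8)
    (hfree : ∀ e ∈ M.E, ∃ A ⊆ M.E \ {e}, e ∉ M.closure A ∧ e ∉ M.closure ((M.E \ {e}) \ A)) (hK : ∀ e, ¬ M.IsColoop e) :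
    {C : Set α | M.IsCircuit C ∧ C.ncard = 3}.ncard ≤ 13 ∧
      {C : Set α | M.IsCircuit C ∧ C.ncard = 4}.ncard ≤ 78 ∧
        {C : Set α | M.IsCircuit C ∧ C.ncard = 5}.ncard ≤ 518 := by
  have hs3 := TriangleCap.core_ncard_triangles_le_cq3 M hfree hd
  rw [show TriangleCap.cq3 8 = 13 by decide] at hs3
  have hcol : M.coloops = ∅ := S2.coloops_eq_empty_of_forall_not M hK
  have hm : 22 ≤ (M.E \ M.coloops).ncard := by
    rw [hcol, Set.sdiff_empty, hn]
  have hd' : M.E.encard = M.eRank + (((7 : ℕ) : ℕ∞) + 1) := by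
    rw [hd]; norm_num
  have h := S1.ncard_fourCircuits_sub_div_le_of_nonColoops M hfree hd' (by norm_num) hm (B := 64)
    (fun M' _ hfree' hd'' => by
      have h := S1.ncard_fourCircuits_le_avgBoundSeven 0 M' hfree' (by convert hd'' using 2; norm_num)
      rw [show S1.avgBoundSeven 0 = 64 by decide] at h
      exact h)
  have hs4 : {C : Set α | M.IsCircuit C ∧ C.ncard = 4}.ncard ≤ 78 := by
    have := S1.le_mul_div_of_sub_div_le (by norm_num : 4 < 22) h
    omega
  have hs5 := S2.ncard_fiveCircuits_le_of_no_coloop M hfree hd' hK (by omega)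
  rw [hn] at hs5
  have h5 : (14 + 8) * S1.avgChain5b 7 / (14 + 8 - 5) = 518 := by
    rw [show S1.avgChain5b 7 = 401 by decide]
  rw [h5] at hs5
  exact ⟨hs3, hs4, hs5⟩

/-- The tail side of the cell `(14, 8)` on the caps `13 / 78 / 518` with the spanning count `S` a parameter: the rank-`≤ 5` part
of the kit's tail is exactly `412433093231 / 2072700 = 198,983.5`, so `1024·(T + S) ≤ m·2^22` whenever `1024·(412433093231 / 2072700 + S) ≤ m·2^22`. -/
theorem tail_fourteen_eight_cfg (S m : ℕ) (h : (1024 : ℚ) * ((412433093231 / 2072700 : ℚ) + (S : ℚ)) ≤ (m : ℚ) * 2 ^ 22) :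
    1024 * ((((14 + 8).choose 4 : ℚ) +
      (∑ j ∈ Finset.range 6, (Nat.choose (min 5 ((8 + 3) / 2 + 1 - 2)) j : ℚ) / (((j + 1) + 3 * (j + 1).choose 2 + 3 * (j + 1).choose 3 + 2 * (j + 1).choose 4 : ℕ) : ℚ)) *
        ((13 * (14 + 8 - 3).choose 2 + 78 * (14 + 8 - 4) + 518 : ℕ) : ℚ) +
      ((∑ j ∈ Finset.range 6, (Nat.choose 5 j : ℚ) / (((j + 1) + 3 * (j + 1).choose 2 + 3 * (j + 1).choose 3 + 2 * (j + 1).choose 4 : ℕ) : ℚ)) -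
        (∑ j ∈ Finset.range 6, (Nat.choose (min 5 ((8 + 3) / 2 + 1 - 2)) j : ℚ) / (((j + 1) + 3 * (j + 1).choose 2 + 3 * (j + 1).choose 3 + 2 * (j + 1).choose 4 : ℕ) : ℚ))) *
        ((10 : ℕ).choose 5 : ℚ)) +
      (((14 + 8).choose 3 * 2 ^ 3 + (14 + 8).choose 2 * 2 + (14 + 8) + 1 : ℕ) : ℚ) +
      (((14 + 8).choose 5 : ℚ) + (∑ j ∈ Finset.range (8), (Nat.choose (min 13 ((8 + 6) / 2 + 1 - 2)) j : ℚ) / (((j + 1) + 3 * (j + 1).choose 2 + 3 * (j + 1).choose 3 + 2 * (j + 1).choose 4 : ℕ) : ℚ)) * ((13 * (14 + 8 - 3).choose 3 + 78 * (14 + 8 - 4).choose 2 + 518 * (14 + 8 - 5) + (8 + 5).choose 6 : ℕ) : ℚ) +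
        ((∑ j ∈ Finset.range (8), (Nat.choose (min 19 (5 + 8) - 6) j : ℚ) / (((j + 1) + 3 * (j + 1).choose 2 + 3 * (j + 1).choose 3 + 2 * (j + 1).choose 4 : ℕ) : ℚ)) - (∑ j ∈ Finset.range (8), (Nat.choose (min 13 ((8 + 6) / 2 + 1 - 2)) j : ℚ) / (((j + 1) + 3 * (j + 1).choose 2 + 3 * (j + 1).choose 3 + 2 * (j + 1).choose 4 : ℕ) : ℚ))) *
        ((min 19 (5 + 8)).choose 6 : ℚ)) +
      (S : ℚ)) ≤ (m : ℚ) * 2 ^ (14 + 8) := by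
  have hsm : (∑ j ∈ Finset.range (8), (Nat.choose (min 13 ((8 + 6) / 2 + 1 - 2)) j : ℚ) / (((j + 1) + 3 * (j + 1).choose 2 + 3 * (j + 1).choose 3 + 2 * (j + 1).choose 4 : ℕ) : ℚ)) = 414767 / 103635 := by
    norm_num [Finset.sum_range_succ, Nat.choose]
  have hsg : (∑ j ∈ Finset.range (8), (Nat.choose (min 19 (5 + 8) - 6) j : ℚ) / (((j + 1) + 3 * (j + 1).choose 2 + 3 * (j + 1).choose 3 + 2 * (j + 1).choose 4 : ℕ) : ℚ)) = 6418141 / 1184400 := by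
    norm_num [Finset.sum_range_succ, Nat.choose]
  have hs4m : (∑ j ∈ Finset.range 6, (Nat.choose (min 5 ((8 + 3) / 2 + 1 - 2)) j : ℚ) / (((j + 1) + 3 * (j + 1).choose 2 + 3 * (j + 1).choose 3 + 2 * (j + 1).choose 4 : ℕ) : ℚ)) = 523 / 225 := by
    norm_num [Finset.sum_range_succ, Nat.choose]
  have hs4g : (∑ j ∈ Finset.range 6, (Nat.choose 5 j : ℚ) / (((j + 1) + 3 * (j + 1).choose 2 + 3 * (j + 1).choose 3 + 2 * (j + 1).choose 4 : ℕ) : ℚ)) = 12767 / 4230 := by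
    norm_num [Finset.sum_range_succ, Nat.choose]
  rw [hsm, hsg, hs4m, hs4g]
  norm_num [Nat.choose] at h ⊢
  linarith

/-- the graded weights of the case `ν = 5`: `σ_lo = 9 / 5` (closures of `≤ 9` points). -/
theorem sig_fourteen_eight_cfg_5_lo : (∑ j ∈ Finset.range (8 - 5), (Nat.choose (10 - 1 - 6) j : ℚ) / (((j + 1) + 3 * (j + 1).choose 2 + 3 * (j + 1).choose 3 + 2 * (j + 1).choose 4 : ℕ) : ℚ)) = 9 / 5 := by
  norm_num [Finset.sum_range_succ, Nat.choose]

/-- the graded weights of the case `ν = 5`: `σ_hi = 11 / 5` (the maximal closures of `10` points). -/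
theorem sig_fourteen_eight_cfg_5_hi : (∑ j ∈ Finset.range (8 - 5), (Nat.choose (10 - 6) j : ℚ) / (((j + 1) + 3 * (j + 1).choose 2 + 3 * (j + 1).choose 3 + 2 * (j + 1).choose 4 : ℕ) : ℚ)) = 11 / 5 := by
  norm_num [Finset.sum_range_succ, Nat.choose]

/-- the graded weights of the case `ν = 4`: `σ_lo = 22 / 15` (closures of `≤ 8` points). -/
theorem sig_fourteen_eight_cfg_4_lo : (∑ j ∈ Finset.range (8 - 5), (Nat.choose (9 - 1 - 6) j : ℚ) / (((j + 1) + 3 * (j + 1).choose 2 + 3 * (j + 1).choose 3 + 2 * (j + 1).choose 4 : ℕ) : ℚ)) = 22 / 15 := by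
  norm_num [Finset.sum_range_succ, Nat.choose]

/-- the graded weights of the case `ν = 4`: `σ_hi = 9 / 5` (the maximal closures of `9` points). -/
theorem sig_fourteen_eight_cfg_4_hi : (∑ j ∈ Finset.range (8 - 5), (Nat.choose (9 - 6) j : ℚ) / (((j + 1) + 3 * (j + 1).choose 2 + 3 * (j + 1).choose 3 + 2 * (j + 1).choose 4 : ℕ) : ℚ)) = 9 / 5 := by
  norm_num [Finset.sum_range_succ, Nat.choose]

/-- the weights of the spread case: `σ_m = 22 / 15`, `σ_g = 22 / 15`. -/
theorem sig_fourteen_eight_cfg_sp_m : (∑ j ∈ Finset.range (8 - 5), (Nat.choose (min (8 - 6) ((8 + 6) / 2 + 1 - 2)) j : ℚ) / (((j + 1) + 3 * (j + 1).choose 2 + 3 * (j + 1).choose 3 + 2 * (j + 1).choose 4 : ℕ) : ℚ)) = 22 / 15 := by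
  norm_num [Finset.sum_range_succ, Nat.choose]

/-- the weights of the spread case, the giant term. -/
theorem sig_fourteen_eight_cfg_sp_g : (∑ j ∈ Finset.range (8 - 5), (Nat.choose (min 8 (5 + 8) - 6) j : ℚ) / (((j + 1) + 3 * (j + 1).choose 2 + 3 * (j + 1).choose 3 + 2 * (j + 1).choose 4 : ℕ) : ℚ)) = 22 / 15 := by
  norm_num [Finset.sum_range_succ, Nat.choose]

/-- **The cell `(14, 8)` by the nested dichotomy with the concentrated tail**: `RLS M 14 5` on every `e`-free core of rank `14` on `22`
points (standard caps `13 / 78 / 518`, `phiK 14 5 ≤ 2^19/12417`; the cases `ν = 7, …, 4` on `≤ 12, …, 9` points each with its own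
spanning count and slack (`full` / `pay` / `flat` / `graded` = the graded partition count), then spread with the kit's tail, slack `196/1024`). -/
theorem c025_fourteen_eight_cfg (M : Matroid α) [M.Finite]
    (hR : M.eRank = ((14 : ℕ) : ℕ∞)) (hn : M.E.ncard = 14 + 8)
    (hfree : ∀ e ∈ M.E, ∃ A ⊆ M.E \ {e}, e ∉ M.closure A ∧ e ∉ M.closure ((M.E \ {e}) \ A)) (hK : ∀ e, ¬ M.IsColoop e) :
    RLS M 14 5 := by
  classical
  have hd : M.E.encard = M.eRank + ((8 : ℕ) : ℕ∞) := by
    rw [hR, ← M.ground_finite.cast_ncard_eq, hn]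
    push_cast
    ring
  obtain ⟨hs3, hs4, hs5⟩ := caps_fourteen_eight_cfg M hd hn hfree hK
  have full : ∀ (k : ℕ) {W : Set α}, W ⊆ M.E → W.encard = M.eRk W + k →
      Matroid.topCount M 14 5 ≤ ∑ m ∈ Finset.Icc 5 8, ∑ j ∈ Finset.Icc (m + k - 8) m,
        W.ncard.choose j * (14 + 8 - W.ncard).choose (m - j) := by
    intro k W hW hWk
    refine (S2.topCount_le_sum_spanning M hR hd 5).trans ?_
    refine Finset.sum_le_sum (fun m _ => ?_)
    have h := S2.ncard_spanning_compl_le_of_nullity M hW hd hWk (m := m)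
    rw [hn] at h
    exact h
  have span : ∀ (k : ℕ) {W : Set α}, W ⊆ M.E → W.encard = M.eRk W + k →
      {X : Set α | X ⊆ M.E ∧ M.eRk X = M.eRank}.ncard ≤ ∑ m ∈ Finset.range (8 + 1), ∑ j ∈ Finset.Icc (m + k - 8) m,
        W.ncard.choose j * (14 + 8 - W.ncard).choose (m - j) := by
    intro k W hW hWk
    have h := S2.ncard_spanning_le_of_nullity M hW hd hWk
    rw [hn] at h
    exact h
  have cell : ∀ (U S m : ℕ), Matroid.topCount M 14 5 ≤ U → {X : Set α | X ⊆ M.E ∧ M.eRk X = M.eRank}.ncard ≤ S → m ≤ 1024 →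
      1024 * (U : ℚ) ≤ ((1024 - m : ℕ) : ℚ) * 2 ^ (8 - 5) * (12417 : ℚ) →
      (1024 : ℚ) * ((412433093231 / 2072700 : ℚ) + (S : ℚ)) ≤ (m : ℚ) * 2 ^ 22 → RLS M 14 5 := by
    intro U S m hU hS hm hpoly htail
    rw [RLS_iff]
    exact c025_core_five_cell_of_topCount_spanning_xqictq5g M 14 8 (by norm_num) hR hn hfree 13 78 518 hs3 hs4 hs5 U hU S hS
      12417 (by norm_num) (phiK 14 5) (by rw [S2.phiK_fourteen_five]; norm_num) ⟨m, hm, hpoly, tail_fourteen_eight_cfg S m htail⟩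
  have cellA : ∀ (U S m : ℕ) (A : ℚ), Matroid.topCount M 14 5 ≤ U → ({X : Set α | X ⊆ M.E ∧ M.eRk X ≤ 5}.ncard : ℚ) ≤ A → {X : Set α | X ⊆ M.E ∧ M.eRk X = M.eRank}.ncard ≤ S → m ≤ 1024 →
      1024 * (U : ℚ) ≤ ((1024 - m : ℕ) : ℚ) * 2 ^ (8 - 5) * (12417 : ℚ) →
      (1024 : ℚ) * (A + (S : ℚ)) ≤ (m : ℚ) * 2 ^ 22 → RLS M 14 5 := by
    intro U S m A hU hA hS hm hpoly htail
    rw [RLS_iff]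
    exact c025_core_five_cell_of_counts_xqictq5g M 14 8 (by norm_num) hR hn U hU A hA S hS
      12417 (by norm_num) (phiK 14 5) (by rw [S2.phiK_fourteen_five]; norm_num) ⟨m, hm, hpoly, htail⟩
  by_cases h7 : ∃ W ⊆ M.E, W.ncard ≤ 12 ∧ W.encard = M.eRk W + 7
  · obtain ⟨W, hW, hWn, hWk⟩ := h7
    have hU' : Matroid.topCount M 14 5 ≤ 33033 := by
      refine (full 7 hW hWk).trans ?_
      generalize W.ncard = w at hWn ⊢
      interval_cases w <;> decide
    have hS' : {X : Set α | X ⊆ M.E ∧ M.eRk X = M.eRank}.ncard ≤ 36817 := by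
      refine (span 7 hW hWk).trans ?_
      generalize W.ncard = w at hWn ⊢
      interval_cases w <;> decide
    exact cell 33033 36817 58 hU' hS' (by norm_num) (by norm_num) (by norm_num)
  by_cases h6 : ∃ W ⊆ M.E, W.ncard ≤ 11 ∧ W.encard = M.eRk W + 6
  · obtain ⟨W, hW, hWn, hWk⟩ := h6
    have hU := topCount_le_flat_count_two_sharp M 14 8 (by norm_num) hR hn hfree hW (by norm_num; exact hWk) hWn (by
      rintro ⟨W', hW'E, hW'n, hW'k⟩
      exact h7 ⟨W', hW'E, by omega, by norm_num at hW'k; exact hW'k⟩)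
    have hU' : Matroid.topCount M 14 5 ≤ 92157 := by
      generalize W.ncard = w at hWn hU
      rw [Finset.sum_Icc_succ_top (by norm_num : 5 ≤ 8), Finset.sum_Icc_succ_top (by norm_num : 5 ≤ 7), Finset.sum_Icc_succ_top (by norm_num : 5 ≤ 6), Finset.Icc_self, Finset.sum_singleton] at hU
      interval_cases w <;> norm_num [Nat.choose] at hU <;>
        first
          | omega
          | (have hUq : (Matroid.topCount M 14 5 : ℚ) ≤ 92157 := by linarith
             exact_mod_cast hUq)
    have hS' : {X : Set α | X ⊆ M.E ∧ M.eRk X = M.eRank}.ncard ≤ 103687 := by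
      refine (span 6 hW hWk).trans ?_
      generalize W.ncard = w at hWn ⊢
      interval_cases w <;> decide
    exact cell 92157 103687 74 hU' hS' (by norm_num) (by norm_num) (by norm_num)
  by_cases h5 : ∃ W ⊆ M.E, W.ncard ≤ 10 ∧ W.encard = M.eRk W + 5
  · obtain ⟨W, hW, hWn, hWk⟩ := h5
    have hflat : ∀ X ⊆ M.E, M.eRk X ≤ 5 → X.ncard ≤ 10 := fun X hX hr => by
      have := S2.ncard_le_of_eRk_le_of_not_nullity M 6 11 (by norm_num) h6 hX (r := 5) (by norm_num) (by exact_mod_cast hr)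
      omega
    have hflat' : ∀ X ⊆ M.E, M.eRk X ≤ 4 → X.ncard ≤ 9 := fun X hX hr => by
      have := S2.ncard_le_of_eRk_le_of_not_nullity M 6 11 (by norm_num) h6 hX (r := 4) (by norm_num) (by exact_mod_cast hr)
      omega
    -- the sub-dichotomy on a rank-`4` flat `G` of `9` points (nullity `5`): with one, `W := G` (`w = 9`), `G` is THE unique such flat
    -- (`eq_of_rank_four_flats_of_big`) and the maximal-closure count runs on two levels (`E = 13` for `G`, `e = 8` for the rest); without, `e = 8`
    -- on every flat and the rank part of the tail runs at `f′ = 8` (`ncard_eRk_le_five_le_flats`)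
    by_cases hG : ∃ G ⊆ M.E, G.ncard = 9 ∧ M.eRk G ≤ 4
    · obtain ⟨G, hG, hGn, hGr⟩ := hG
      have hC2 : ∀ P ⊆ M.E, M.eRk P ≤ 3 → P.ncard ≤ 6 := fun P hP hr => ncard_le_six_of_eRk_le_three_of_free M hfree hP hr
      have hGr4 : M.eRk G = 4 := by
        obtain ⟨q, hq⟩ := ENat.ne_top_iff_exists.1 (S2.eRk_ne_top_of_finite hG)
        rw [← hq] at hGr ⊢
        have hq4 : q ≤ 4 := by exact_mod_cast hGr
        by_contra hne
        have hq3 : q ≤ 3 := by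
          have : q ≠ 4 := fun h => hne (by rw [h]; exact Nat.cast_ofNat)
          omega
        have := hC2 G hG (by rw [← hq]; exact_mod_cast hq3)
        omega
      have hGk : G.encard = M.eRk G + 5 := by
        rw [hGr4, ← (M.ground_finite.subset hG).cast_ncard_eq, hGn]
        norm_num
      have hGflat : M.closure G = G := by
        refine (Set.eq_of_subset_of_ncard_le (M.subset_closure G hG) ?_ (M.ground_finite.subset (M.closure_subset_ground G))).symm
        rw [hGn]
        exact hflat' _ (M.closure_subset_ground G) (by rw [M.eRk_closure_eq, hGr4])
      have hGbig : ({x ∈ M.E \ G | (M.closure (insert x G)).ncard = 10}).ncard ≤ 13 := by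
        refine (S2.card_maxExt_le_ncard_diff G 10).trans ?_
        rw [Set.ncard_sdiff hG (M.ground_finite.subset hG), hn, hGn]
      have he : ∀ P ⊆ M.E, M.closure P = P → M.eRk P = 4 → 5 ≤ P.ncard → P ≠ G →
          ({x ∈ M.E \ P | (M.closure (insert x P)).ncard = 10}).ncard ≤ 8 := by
        intro P hP hPflat hPr hP5 hPG
        have hq0 : P.ncard ≤ 9 := hflat' P hP (le_of_eq hPr)
        have hq : P.ncard ≤ 8 := by
          by_contra hlt
          have hPk : 4 + 5 ≤ P.ncard := by omega
          exact hPG (eq_of_rank_four_flats_of_big M hR hn hfree (fun X hX hr => by have := hflat X hX hr; omega) (by norm_num) (by norm_num) hP hPflat hPr hPk hG hGflat hGr4 (by omega))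
        have hPr' : M.eRk P = ((4 : ℕ) : ℕ∞) := by exact_mod_cast hPr
        by_cases hq2 : P.ncard + 2 ≤ 10
        · refine (S2.card_maxExt_le hR hn hP hPflat hPr' 10 hq2).trans ?_
          generalize P.ncard = q at hq hq2 hP5 ⊢
          interval_cases q <;> decide
        · refine (S2.card_maxExt_le_ncard_diff P 10).trans ?_
          rw [Set.ncard_sdiff hP (M.ground_finite.subset hP), hn]
          omega
      have hV := S2.ncard_spanning_compl_le_of_nullity M hG hd hGk (m := 5)
      have hV' : ∑ j ∈ Finset.Icc (5 + 5 - 8) 5, G.ncard.choose j * (M.E.ncard - G.ncard).choose (5 - j) ≤ 18612 := by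
        rw [hn]
        rw [hGn]
        decide
      have hU := topCount_le_payment_graded_two M 14 8 (by norm_num) hR hn hfree 10 hflat
        13 78 518 hs3 hs4 hs5 8 13 (by norm_num) hG 9 hGn hGbig he 18612 (hV.trans hV')
      rw [sig_fourteen_eight_cfg_5_lo, sig_fourteen_eight_cfg_5_hi] at hU
      norm_num [Nat.choose] at hU
      have hU' : Matroid.topCount M 14 5 ≤ 90993 := hU.trans (by norm_num)
      have hS' : {X : Set α | X ⊆ M.E ∧ M.eRk X = M.eRank}.ncard ≤ 152637 := by
        refine (span 5 hG hGk).trans ?_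
        rw [hGn]
        decide
      exact cell 90993 152637 86 hU' hS' (by norm_num) (by norm_num) (by norm_num)
    · push Not at hG
      have hflat'' : ∀ X ⊆ M.E, M.eRk X ≤ 4 → X.ncard ≤ 8 := by
        intro X hX hr
        have h1 := hflat' X hX hr
        by_contra hlt
        have h2 : X.ncard = 9 := by omega
        exact absurd hr (not_le.2 (hG X hX h2))
      have he : ∀ P ⊆ M.E, M.closure P = P → M.eRk P = 4 → 5 ≤ P.ncard →
          ({x ∈ M.E \ P | (M.closure (insert x P)).ncard = 10}).ncard ≤ 8 := by
        intro P hP hPflat hPr hP5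
        have hq : P.ncard ≤ 8 := hflat'' P hP (le_of_eq hPr)
        have hPr' : M.eRk P = ((4 : ℕ) : ℕ∞) := by exact_mod_cast hPr
        by_cases hq2 : P.ncard + 2 ≤ 10
        · refine (S2.card_maxExt_le hR hn hP hPflat hPr' 10 hq2).trans ?_
          generalize P.ncard = q at hq hq2 hP5 ⊢
          interval_cases q <;> decide
        · refine (S2.card_maxExt_le_ncard_diff P 10).trans ?_
          rw [Set.ncard_sdiff hP (M.ground_finite.subset hP), hn]
          omega
      have hV := S2.ncard_spanning_compl_le_of_nullity M hW hd hWk (m := 5)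
      have hV' : ∑ j ∈ Finset.Icc (5 + 5 - 8) 5, W.ncard.choose j * (M.E.ncard - W.ncard).choose (5 - j) ≤ 20592 := by
        rw [hn]
        generalize W.ncard = w at hWn ⊢
        interval_cases w <;> decide
      have hU := topCount_le_payment_graded_of_ext M 14 8 (by norm_num) hR hn hfree 10 hflat
        13 78 518 hs3 hs4 hs5 8 he 20592 (hV.trans hV')
      rw [sig_fourteen_eight_cfg_5_lo, sig_fourteen_eight_cfg_5_hi] at hU
      norm_num [Nat.choose] at hU
      have hU' : Matroid.topCount M 14 5 ≤ 91090 := hU.trans (by norm_num)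
      have hA := ncard_eRk_le_five_le_flats M 14 8 (by norm_num) hR hn hfree 10 8 hflat hflat'' (by norm_num) (by norm_num) (by norm_num) (by norm_num)
        13 78 518 hs3 hs4 hs5
      have hA' : ({X : Set α | X ⊆ M.E ∧ M.eRk X ≤ 5}.ncard : ℚ) ≤ 13550889 / 100 := by
        norm_num [Finset.sum_range_succ, Nat.choose] at hA
        linarith
      have hS' : {X : Set α | X ⊆ M.E ∧ M.eRk X = M.eRank}.ncard ≤ 208957 := by
        refine (span 5 hW hWk).trans ?_
        generalize W.ncard = w at hWn ⊢
        interval_cases w <;> decide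
      exact cellA 91090 208957 85 (13550889 / 100) hU' hA' hS' (by norm_num) (by norm_num) (by norm_num)
  by_cases h4 : ∃ W ⊆ M.E, W.ncard ≤ 9 ∧ W.encard = M.eRk W + 4
  · obtain ⟨W, hW, hWn, hWk⟩ := h4
    have hflat : ∀ X ⊆ M.E, M.eRk X ≤ 5 → X.ncard ≤ 9 := fun X hX hr => by
      have := S2.ncard_le_of_eRk_le_of_not_nullity M 5 10 (by norm_num) h5 hX (r := 5) (by norm_num) (by exact_mod_cast hr)
      omega
    have hflat' : ∀ X ⊆ M.E, M.eRk X ≤ 4 → X.ncard ≤ 8 := fun X hX hr => by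
      have := S2.ncard_le_of_eRk_le_of_not_nullity M 5 10 (by norm_num) h5 hX (r := 4) (by norm_num) (by exact_mod_cast hr)
      omega
    have he : ∀ P ⊆ M.E, M.closure P = P → M.eRk P = 4 → 5 ≤ P.ncard →
        ({x ∈ M.E \ P | (M.closure (insert x P)).ncard = 9}).ncard ≤ 14 := by
      intro P hP hPflat hPr hP5
      have hq : P.ncard ≤ 8 := hflat' P hP (le_of_eq hPr)
      have hPr' : M.eRk P = ((4 : ℕ) : ℕ∞) := by exact_mod_cast hPr
      by_cases hq2 : P.ncard + 2 ≤ 9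
      · refine (S2.card_maxExt_le hR hn hP hPflat hPr' 9 hq2).trans ?_
        generalize P.ncard = q at hq hq2 hP5 ⊢
        interval_cases q <;> decide
      · refine (S2.card_maxExt_le_ncard_diff P 9).trans ?_
        rw [Set.ncard_sdiff hP (M.ground_finite.subset hP), hn]
        omega
    have hV := S2.ncard_spanning_compl_le_of_nullity M hW hd hWk (m := 5)
    have hV' : ∑ j ∈ Finset.Icc (5 + 4 - 8) 5, W.ncard.choose j * (M.E.ncard - W.ncard).choose (5 - j) ≤ 25047 := by
      rw [hn]
      generalize W.ncard = w at hWn ⊢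
      interval_cases w <;> decide
    have hU := topCount_le_payment_graded_of_ext M 14 8 (by norm_num) hR hn hfree 9 hflat
      13 78 518 hs3 hs4 hs5 14 he 25047 (hV.trans hV')
    rw [sig_fourteen_eight_cfg_4_lo, sig_fourteen_eight_cfg_4_hi] at hU
    norm_num [Nat.choose] at hU
    have hUq : (Matroid.topCount M 14 5 : ℚ) ≤ 86627 := by linarith
    have hU' : Matroid.topCount M 14 5 ≤ 86627 := by exact_mod_cast hUq
    have hS' : {X : Set α | X ⊆ M.E ∧ M.eRk X = M.eRank}.ncard ≤ 335677 := by
      refine (span 4 hW hWk).trans ?_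
      generalize W.ncard = w at hWn ⊢
      interval_cases w <;> decide
    exact cell 86627 335677 131 hU' hS' (by norm_num) (by norm_num) (by norm_num)
  · -- spread: rank-`5` sets `≤ 8`, rank-`4` sets `≤ 7`; the kit's spanning bound `Σ_{j ≤ 8} C(22, j) = 600370`
    have hflat : ∀ X ⊆ M.E, M.eRk X ≤ 5 → X.ncard ≤ 8 := fun X hX hr => by
      have := S2.ncard_le_of_eRk_le_of_not_nullity M 4 9 (by norm_num) h4 hX (r := 5) (by norm_num) (by exact_mod_cast hr)
      omega
    have hflat' : ∀ X ⊆ M.E, M.eRk X ≤ 4 → X.ncard ≤ 7 := fun X hX hr => by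
      have := S2.ncard_le_of_eRk_le_of_not_nullity M 4 9 (by norm_num) h4 hX (r := 4) (by norm_num) (by exact_mod_cast hr)
      omega
    have hU := topCount_le_flat M 14 8 (by norm_num) hR hn hfree 8 7 hflat hflat' (by norm_num) (by norm_num)
      13 78 518 hs3 hs4 hs5
    rw [sig_fourteen_eight_cfg_sp_m, sig_fourteen_eight_cfg_sp_g] at hU
    norm_num [Nat.choose] at hU
    have hUq : (Matroid.topCount M 14 5 : ℚ) ≤ 80322 := by linarith
    have hU' : Matroid.topCount M 14 5 ≤ 80322 := by exact_mod_cast hUq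
    have hEcard : M.ground_finite.toFinset.card = 14 + 8 := by
      rw [← Set.ncard_eq_toFinset_card _ M.ground_finite]; exact hn
    have hS := Matroid.ncard_spanning_le (M := M) hd
    rw [hEcard] at hS
    have hS' : {X : Set α | X ⊆ M.E ∧ M.eRk X = M.eRank}.ncard ≤ 600370 := hS.trans (by decide)
    exact cell 80322 600370 196 hU' hS' (by norm_num) (by norm_num) (by norm_num)

end ThmN

end PercRepro
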